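import Literature.AlgebraicGeometry.Motives.FaltingsTateBiprodAdditivity
import Literature.AlgebraicGeometry.ComplexMultiplication.PrincipalModelOfCMOrder
import HarnessLib

/-!
# [Faltings 1983, §5 Kor. 1] for finite biproducts, from the pairs of factors

Theorems only (topic `AlgebraicGeometry/Motives`; no definition, no named fact, no instance).
Sequel of `FaltingsTateBiprodAdditivity` (binary biproducts `A₁ ⊞ A₂`): the statement
`faltings_tate_bijective A B ℓ` ([Fal83 §5 Kor. 1]: over a number field the Tate map
`ℤ_ℓ ⊗ Hom_K(A, B) → Hom_{Γ_K}(T_ℓ A, T_ℓ B)` is bijective) holds for a pair of FINITE biproducts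
`(⨁_{j ∈ J} A_j, ⨁_{j' ∈ J'} B_{j'})` as soon as it holds for every pair of factors `(A_j, B_{j'})`
(`faltings_tate_bijective_biproduct_biproduct`; one-sided forms `…_biproduct_left/right`; the
empty biproduct is allowed on either side).  SURJECTIVITY: an equivariant
`g : T_ℓ(⨁ A_j) → T_ℓ B` is `Σ_j g ∘ T_ℓ(ι_j) ∘ T_ℓ(π_j)` (`Σ_j π_j ≫ ι_j = 𝟙`, `biproduct.total`, and
`T_ℓ` is additive), and each `g ∘ T_ℓ(ι_j)` is equivariant `T_ℓ A_j → T_ℓ B`, hence in the span of the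
`T_ℓ f`, `f ∈ Hom(A_j, B)`, a span stable under `∘ T_ℓ(π_j)` (`mem_span_tateModuleMap_comp_of_mem_span`);
symmetrically in the target.  Finite biproducts in `AbelianVariety K`: the instance
`AbelianVariety.hasFiniteBiproducts_inst` (`ComplexMultiplication/PrincipalModelOfCMOrder`).  INJECTIVITY is Mumford §19 Thm. 3 for every pair
(`faltingsTateMap_injective_holds`).  Kieffer 2024 §1.2.2 p. 22: `Hom(∏ A_i, ∏ B_j) = ⊕ Hom(A_i, B_j)`
on both sides of the Tate map.  Consumers: isogeny classes of products of powers of CM abelian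
varieties (`NumberTheory/ComplexMultiplication/FaltingsTateOf…Products`), where the corners are
decided structure by structure.

## References

* [Faltings1983Endlichkeit] G. Faltings, Invent. Math. 73 (1983), §5 Korollar 1.
* [MumfordAV1970] D. Mumford, *Abelian Varieties* (1970), §19 Theorem 3 and p. 176.
* [Kieffer2024IsogenyGraphs] J. Kieffer (2024), §1.2.2 p. 22.
-/

noncomputable section

universe u

open CategoryTheory CategoryTheory.Limits
open scoped TensorProduct

namespace Literature.AlgebraicGeometry.Motives

namespace AbelianVariety

variable {K : Type u} [Field K] (ℓ : ℕ) [Fact ℓ.Prime]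

/-- `T_ℓ` is additive on finite sums of homomorphisms: `T_ℓ(Σ_{j ∈ s} f_j) = Σ_{j ∈ s} T_ℓ f_j`.
[cite: MumfordAV1970, §19 Theorem 3 (p. 176, additivity of `T_ℓ`)] -/
private theorem tateModuleMap_finsetSum {A B : AbelianVariety K} {I : Type*} (s : Finset I)
    (f : I → (A ⟶ B)) : tateModuleMap ℓ (∑ i ∈ s, f i) = ∑ i ∈ s, tateModuleMap ℓ (f i) :=
  map_sum (AddMonoidHom.mk' (fun g : A ⟶ B ↦ tateModuleMap ℓ g) (tateModuleMap_add ℓ)) f s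

/-- `Σ_j T_ℓ(ι_j) ∘ T_ℓ(π_j) = id` on `T_ℓ(⨁_j A_j)` (`T_ℓ` applied to `biproduct.total`).
[cite: MumfordAV1970, §19 Theorem 3 (p. 176, additivity of `T_ℓ`)] -/
private theorem sum_tateModuleMap_ι_comp_π {J : Type} [Fintype J] (A : J → AbelianVariety K) :
    ∑ j, (tateModuleMap ℓ (biproduct.ι A j)).comp (tateModuleMap ℓ (biproduct.π A j)) =
      (LinearMap.id : (⨁ A).tateModule ℓ →ₗ[ℤ_[ℓ]] (⨁ A).tateModule ℓ) := by
  classical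
  have h := congrArg (tateModuleMap ℓ) (biproduct.total : ∑ j : J, biproduct.π A j ≫ biproduct.ι A j = 𝟙 (⨁ A))
  rw [tateModuleMap_finsetSum, tateModuleMap_id] at h
  rw [← h]
  exact Finset.sum_congr rfl fun j _ ↦ (tateModuleMap_comp ℓ _ _).symm

/-- **Surjectivity of the Tate map is additive over a finite biproduct in the source**: if
`ℤ_ℓ ⊗ Hom(A_j, B) → Hom_Γ(T_ℓ A_j, T_ℓ B)` is onto for every `j`, then so is
`ℤ_ℓ ⊗ Hom(⨁_j A_j, B) → Hom_Γ(T_ℓ(⨁_j A_j), T_ℓ B)` (`g = Σ_j g T(ι_j) T(π_j)`, each summand in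
the span of the `T_ℓ h`). [cite: MumfordAV1970, §19 Theorem 3 (p. 176, additivity of `T_ℓ`)]
[cite: Kieffer2024IsogenyGraphs, §1.2.2 p. 22] -/
theorem surjective_faltingsTateMap_biproduct_left {J : Type} [Fintype J] (A : J → AbelianVariety K)
    (B : AbelianVariety K) (h : ∀ j, Function.Surjective (faltingsTateMap (A j) B ℓ)) :
    Function.Surjective (faltingsTateMap (⨁ A) B ℓ) := by
  classical
  refine surjective_faltingsTateMap_of_forall_mem_span ℓ fun g ↦ ?_
  have hg : ∀ j, (g.comp (tateIntertwiningMap ℓ (biproduct.ι A j))).toLinearMap.comp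
      (tateModuleMap ℓ (biproduct.π A j)) ∈
        Submodule.span ℤ_[ℓ] (Set.range (tateModuleMap ℓ : ((⨁ A) ⟶ B) → _)) := fun j ↦
    mem_span_tateModuleMap_comp_of_mem_span ℓ (biproduct.π A j)
      (toLinearMap_mem_span_of_surjective ℓ (h j) (g.comp (tateIntertwiningMap ℓ (biproduct.ι A j))))
  have hsum : g.toLinearMap = ∑ j, (g.comp (tateIntertwiningMap ℓ (biproduct.ι A j))).toLinearMap.comp
      (tateModuleMap ℓ (biproduct.π A j)) := by
    refine LinearMap.ext fun x ↦ ?_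
    have hx := congrArg (fun f ↦ f x) (sum_tateModuleMap_ι_comp_π ℓ A)
    simp only [LinearMap.sum_apply, LinearMap.comp_apply, LinearMap.id_apply] at hx
    simp only [Representation.IntertwiningMap.comp_toLinearMap, toLinearMap_tateIntertwiningMap,
      LinearMap.sum_apply, LinearMap.comp_apply]
    rw [← map_sum g.toLinearMap, hx]
  rw [hsum]
  exact Submodule.sum_mem _ fun j _ ↦ hg j

/-- **Surjectivity of the Tate map is additive over a finite biproduct in the target**: if
`ℤ_ℓ ⊗ Hom(A, B_j) → Hom_Γ(T_ℓ A, T_ℓ B_j)` is onto for every `j`, then so is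
`ℤ_ℓ ⊗ Hom(A, ⨁_j B_j) → Hom_Γ(T_ℓ A, T_ℓ(⨁_j B_j))` (`g = Σ_j T(ι_j) T(π_j) g`).
[cite: MumfordAV1970, §19 Theorem 3 (p. 176, additivity of `T_ℓ`)] [cite: Kieffer2024IsogenyGraphs, §1.2.2 p. 22] -/
theorem surjective_faltingsTateMap_biproduct_right {J : Type} [Fintype J] (A : AbelianVariety K)
    (B : J → AbelianVariety K) (h : ∀ j, Function.Surjective (faltingsTateMap A (B j) ℓ)) :
    Function.Surjective (faltingsTateMap A (⨁ B) ℓ) := by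
  classical
  refine surjective_faltingsTateMap_of_forall_mem_span ℓ fun g ↦ ?_
  have hg : ∀ j, (tateModuleMap ℓ (biproduct.ι B j)).comp
      ((tateIntertwiningMap ℓ (biproduct.π B j)).comp g).toLinearMap ∈
        Submodule.span ℤ_[ℓ] (Set.range (tateModuleMap ℓ : (A ⟶ ⨁ B) → _)) := fun j ↦
    comp_mem_span_tateModuleMap_of_mem_span ℓ (biproduct.ι B j)
      (toLinearMap_mem_span_of_surjective ℓ (h j) ((tateIntertwiningMap ℓ (biproduct.π B j)).comp g))
  have hsum : g.toLinearMap = ∑ j, (tateModuleMap ℓ (biproduct.ι B j)).comp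
      ((tateIntertwiningMap ℓ (biproduct.π B j)).comp g).toLinearMap := by
    refine LinearMap.ext fun x ↦ ?_
    have hx := congrArg (fun f ↦ f (g.toLinearMap x)) (sum_tateModuleMap_ι_comp_π ℓ B)
    simp only [LinearMap.sum_apply, LinearMap.comp_apply, LinearMap.id_apply] at hx
    simp only [Representation.IntertwiningMap.comp_toLinearMap, toLinearMap_tateIntertwiningMap,
      LinearMap.sum_apply, LinearMap.comp_apply]
    exact hx.symm
  rw [hsum]
  exact Submodule.sum_mem _ fun j _ ↦ hg j

/-- **[Fal83 §5 Kor. 1] is additive over a finite biproduct in the source**: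
`faltings_tate_bijective (A_j) B ℓ` for all `j` implies `faltings_tate_bijective (⨁_j A_j) B ℓ`
(surjectivity by `surjective_faltingsTateMap_biproduct_left`; injectivity is Mumford §19 Thm. 3,
`faltingsTateMap_injective_holds`). [cite: Faltings1983Endlichkeit, §5 Korollar 1]
[cite: MumfordAV1970, §19 Theorem 3] -/
theorem faltings_tate_bijective_biproduct_left {J : Type} [Fintype J] (A : J → AbelianVariety K)
    (B : AbelianVariety K) (h : ∀ j, faltings_tate_bijective (A j) B ℓ) :
    faltings_tate_bijective (⨁ A) B ℓ := fun {_} ↦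
  ⟨faltingsTateMap_injective_holds _ _ ℓ (natCast_ne_zero_of_numberField ℓ),
    surjective_faltingsTateMap_biproduct_left ℓ A B fun j ↦ (h j).2⟩

/-- **[Fal83 §5 Kor. 1] is additive over a finite biproduct in the target**:
`faltings_tate_bijective A (B_j) ℓ` for all `j` implies `faltings_tate_bijective A (⨁_j B_j) ℓ`.
[cite: Faltings1983Endlichkeit, §5 Korollar 1] [cite: MumfordAV1970, §19 Theorem 3] -/
theorem faltings_tate_bijective_biproduct_right {J : Type} [Fintype J] (A : AbelianVariety K)
    (B : J → AbelianVariety K) (h : ∀ j, faltings_tate_bijective A (B j) ℓ) :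
    faltings_tate_bijective A (⨁ B) ℓ := fun {_} ↦
  ⟨faltingsTateMap_injective_holds _ _ ℓ (natCast_ne_zero_of_numberField ℓ),
    surjective_faltingsTateMap_biproduct_right ℓ A B fun j ↦ (h j).2⟩

/-- **[Fal83 §5 Kor. 1] for a pair of finite biproducts from the pairs of factors**:
`faltings_tate_bijective (⨁_j A_j) (⨁_{j'} B_{j'}) ℓ` from the statement for every `(A_j, B_{j'})`.
[cite: Faltings1983Endlichkeit, §5 Korollar 1] [cite: Kieffer2024IsogenyGraphs, §1.2.2 p. 22] -/
theorem faltings_tate_bijective_biproduct_biproduct {J J' : Type} [Fintype J] [Fintype J']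
    (A : J → AbelianVariety K) (B : J' → AbelianVariety K)
    (h : ∀ j j', faltings_tate_bijective (A j) (B j') ℓ) :
    faltings_tate_bijective (⨁ A) (⨁ B) ℓ :=
  faltings_tate_bijective_biproduct_left ℓ A (⨁ B) fun j ↦
    faltings_tate_bijective_biproduct_right ℓ (A j) B (h j)

/-- **… and for their isogeny classes**: if `A' ∼ ⨁_j A_j` and `B' ∼ ⨁_{j'} B_{j'}` over a number
field, the statement for every pair of factors gives `faltings_tate_bijective A' B' ℓ`
(`faltings_tate_bijective_of_isIsogenous`). [cite: Faltings1983Endlichkeit, §5 Korollar 1 and proof of Satz 4 (first sentence)] -/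
theorem faltings_tate_bijective_of_isIsogenous_biproduct_biproduct {J J' : Type} [Fintype J]
    [Fintype J'] (A : J → AbelianVariety K) (B : J' → AbelianVariety K) {A' B' : AbelianVariety K}
    (hA : IsIsogenous (⨁ A) A') (hB : IsIsogenous (⨁ B) B')
    (h : ∀ j j', faltings_tate_bijective (A j) (B j') ℓ) :
    faltings_tate_bijective A' B' ℓ :=
  faltings_tate_bijective_of_isIsogenous ℓ hA hB (faltings_tate_bijective_biproduct_biproduct ℓ A B h)

end AbelianVariety

end Literature.AlgebraicGeometry.Motives

end
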